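import Summits.BirchSwinnertonDyer.Rank1Residual.X11b.CongruenceLimitOneSided
import Literature.RingTheory.FittingIdeal.DiscreteValuationRing
import HarnessLib

/-!
# X11b, routes R1/p2 — the one-sided congruence limit AT THE TRIVIAL CHARACTER, coinvariant
# form: `length_𝒪(𝒪/(L^Σ_p(f)(𝟙))) ≤ length_𝒪(X_Γ)` with no input on `X = X^Σ_ac(E[p^∞])` at all

HONEST FRAMING (cell `b2b-bsdres`, run/shared/lean/b2b/bsd-rank1-residual/, verbatim in every
file): the goal of the cell is to DELETE the COMBINATION-SHAPED residual classes of the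
Birch–Swinnerton-Dyer formula for ALL analytic-rank `≤ 1` elliptic curves over `ℚ` — "full BSD
formula for every rank `≤ 1` curve in class `C`" assembled STRICTLY from published theorems — so
that the rank-`≤ 1` remainder becomes exactly the CONSTRUCTION-SHAPED classes, which are TYPED
(missing-input `Prop`s), NOT attempted. This is not "finishing BSD". Sub-cell
`b2b-bsdres-multr1-p1` (X11b via the re-proof of Castella 2018 Thm. A along the author's erratum):
a RESEARCH ROUTE; no claim beyond the stated class; X11b stays CONSTRUCTION-SHAPED; nothing here
changes a label; no named fact is introduced (theorems only; no `sorry`).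

## What this file kernel-checks

`CongruenceLimitOneSided.lean` (this gen) transfers the Greenberg-side divisibility (2.5) for the
approximating forms `g_m` to `Fitt_Λ(X) ⊆ (L)` for `X = X^Σ_ac(E[p^∞])`, `L = L^Σ_p(f)`
(`fittingIdeal_le_span_of_congruences`), and then to `Ch_Λ(X) ⊆ (L)` using two inputs ON `X`
(torsion, no finite submodule — query Q5). Route p2 consumes the result only at the trivial
character `𝟙` (`T ↦ 0`), through the control theorem. THIS FILE removes the two inputs on `X` by
staying with Fitting ideals, which — unlike characteristic ideals — commute with base change:
along ANY `R`-algebra `S` (the augmentation `Λ → Λ/(T) = 𝒪`, `Λ^{ur} → R₀`),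
`Fitt_S(S ⊗_Λ X) = Fitt_Λ(X)·S ⊆ (L(𝟙))` (`fittingIdeal_baseChange_le_span`, tree
`Module.fittingIdeal_baseChange`, Stacks 07ZA); and over a discrete valuation ring `S`,
`Fitt_S(N) ⊆ 𝔞` forces `length_S(S/𝔞) ≤ length_S(N)` (tree
`Module.length_quotient_le_length_of_fittingIdeal_zero_le`, de Smit–Rubin–Schoof `Fit = 𝔪^{length}`).
Hence (`length_quotient_le_length_baseChange_of_congruences`):

  **`length_𝒪(𝒪/(L^Σ_p(f)(𝟙))) ≤ length_𝒪(X_Γ)`**, `X_Γ = X/TX = 𝒪 ⊗_Λ X`,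

i.e. for `𝒪 = ℤ_p` / `R₀ = W(𝔽̄_p)`: `ord_p L^Σ_p(f)(𝟙) ≤ ord_p #X^Σ_ac(E[p^∞])_Γ` (both sides `∞`
allowed), from: (2.5) for the `g_m` [[FW21, Thm. 4.41] for crystalline `g_m`, within its printed
hypotheses — PREPRINT; + [FO12, Cor. 7.2.1], [CGS23, Prop. 1.4.5], [JSW17, Cor. 3.4.2], PUB], (b) +
Lemma 2.1 [Hida theory, PUB; Lemma 2.1 KERNEL `selmerTorsionEquiv_of_socle` + Pontryagin duality
KERNEL], (c) [[Cas20, Thm. 2.11], PUB] — and NOTHING about `X`: no torsionness, no Lemma 2.2, no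
`L ≠ 0`, no Euler system. `X_Γ` is the Pontryagin dual of `Sel^Σ_𝔭(K_∞, E[p^∞])^Γ`, the object
Greenberg's control theorem computes DIRECTLY in terms of `Sel_{p^∞}(E/K)`, `Ш(E/K)[p^∞]`,
`[E(K):ℤP]`, the anomalous/`log` term at `𝔭` and the Tamagawa and `Σ`-local factors ([JSW17,
§3.3], standing hypothesis (sst) including multiplicative `p`; Cas18 Thm. 2.3 is this computation
followed by the Euler-characteristic step `#ℤ_p/f_ac(0) = #X_Γ/#X^Γ`, `X^Γ = 0`). So on route
p2's `Locus` the lower-bound half STEP L needs, besides PUBLISHED links, exactly ONE unrefereed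
statement — [FW21, Thm. 4.41] applied inside its hypotheses — and none of the inputs questioned in
Q1/Q3/Q5. (The cell's typed (CTL) link `LambdaAdicShadow.ControlAt` is in the `f_ac(0)`-form of
Cas18 Thm. 2.3; reading it in `X_Γ`-form is a re-typing for multr1-p2 / the literature seat, not
done here.) Bookkeeping only: labels unchanged, nothing booked, X11b CONSTRUCTION-SHAPED.

Dictionary: `R = Λ_𝒪` or `Λ_𝒪^{ur}` (any commutative ring for §1; Noetherian with `I ⊆ Jac(R)`
for the limit), `S` = the residue ring of the augmentation (`𝒪`, `R₀`; any DVR `R`-algebra),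
`algebraMap R S = ` evaluation at `𝟙`, `S ⊗_R M = M/TM = M_Γ`.

References: [Castella2018Erratum] p. 4; [Skinner2016PacificMC] §3.1; [FouquetWan2021] Thm. 4.41;
[JetchevSkinnerWan2017] §3.3, Cor. 3.4.2, §7.4.1; The Stacks Project, Tag 07ZA [StacksProject];
B. de Smit, K. Rubin, R. Schoof, *Criteria for complete intersections* (1997) §1 [DeSmitRubinSchoof1997].
-/

noncomputable section

open scoped TensorProduct

open Literature.RingTheory.FittingIdeal Literature.NumberTheory.EllipticCurves
  Literature.NumberTheory.EllipticCurves.Module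

namespace Summit.BirchSwinnertonDyer.Rank1Residual.X11b.CongruenceLimit

universe u v

section Coinvariants

variable {R : Type u} [CommRing R] (S : Type v) [CommRing S] [Algebra R S]
  {M : Type*} [AddCommGroup M] [Module R M] [Module.Finite R M]

/-- **Fitting ideals commute with base change, inclusion form**: `Fitt_R(M) ⊆ (L)` gives
`Fitt_S(S ⊗_R M) ⊆ (L·1_S)` for every `R`-algebra `S` (specialisation at the trivial character:
`S = Λ/(T)`). [cite: StacksProject, Tag 07ZA (3)] -/
theorem fittingIdeal_baseChange_le_span {L : R} (h : Module.fittingIdeal R M 0 ≤ Ideal.span {L}) :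
    Module.fittingIdeal S (S ⊗[R] M) 0 ≤ Ideal.span {algebraMap R S L} := by
  rw [Module.fittingIdeal_baseChange]
  refine (Ideal.map_mono h).trans (le_of_eq ?_)
  rw [Ideal.map_span, Set.image_singleton]

/-- **Over a discrete valuation ring `S`, `Fitt_R(M) ⊆ (L)` bounds the length of the base change
from below by the valuation of `L(𝟙)`**: `length_S(S/(L·1_S)) ≤ length_S(S ⊗_R M)` (in `ℕ∞`; the
left side is `v_S(L·1_S)`, or `⊤` if `L ↦ 0`). [cite: DeSmitRubinSchoof1997, §1, p. 347 (Fit = 𝔪^length)] -/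
theorem length_quotient_span_le_length_baseChange [IsDomain S] [IsDiscreteValuationRing S] {L : R}
    (h : Module.fittingIdeal R M 0 ≤ Ideal.span {L}) :
    Module.length S (S ⧸ Ideal.span {algebraMap R S L}) ≤ Module.length S (S ⊗[R] M) :=
  Module.length_quotient_le_length_of_fittingIdeal_zero_le (fittingIdeal_baseChange_le_span S h)

variable (I : Ideal R) {L : R}
  (N : ℕ → Type*) [∀ m, AddCommGroup (N m)] [∀ m, Module R (N m)] [∀ m, Module.Finite R (N m)]
  (Lm : ℕ → R)

/-- **The one-sided congruence limit at the trivial character, coinvariant form.** `R` Noetherian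
(`Λ_𝒪`, `Λ_𝒪^{ur}`), `I ⊆ Jac(R)` (`(p)`, `(ϖ)`), `S` a discrete valuation ring and `R`-algebra
(`𝒪 = Λ/(T)`, `R₀`: evaluation at `𝟙`), `M` finite (`X^Σ_ac(E[p^∞])`); for every `m ≥ 1`:
`e : M/I^m ≅ N_m/I^m` [(b) + Lemma 2.1], `hF : Fitt₀(N_m) ⊆ (L_m)` [(2.5) for `g_m`, via
`fittingIdeal_zero_le_of_charIdeal_le`], `hc : (L_m) + I^m = (L) + I^m` [(c)]. THEN
`length_S(S/(L(𝟙))) ≤ length_S(M_Γ)` with `M_Γ = S ⊗_R M`: the lower bound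
`ord L^Σ_p(f)(𝟙) ≤ ord #X^Σ_ac(E[p^∞])_Γ` that the control theorem turns into STEP L. No
hypothesis on `M` beyond finiteness. Pure algebra; CONDITIONAL on nothing; deletes nothing.
[cite: Castella2018Erratum, proof of Thm. 1.1 (p. 4), read one-sidedly at the trivial character]
[cite: JetchevSkinnerWan2017, §7.4.1 (the lower bound from the Greenberg-side divisibility)] -/
theorem length_quotient_le_length_baseChange_of_congruences [IsNoetherianRing R]
    [IsDomain S] [IsDiscreteValuationRing S] (hI : I ≤ (⊥ : Ideal R).jacobson)
    (e : ∀ m : ℕ, 1 ≤ m →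
      ((M ⧸ (I ^ m • (⊤ : Submodule R M))) ≃ₗ[R] (N m ⧸ (I ^ m • (⊤ : Submodule R (N m))))))
    (hF : ∀ m : ℕ, 1 ≤ m → Module.fittingIdeal R (N m) 0 ≤ Ideal.span {Lm m})
    (hc : ∀ m : ℕ, 1 ≤ m → Ideal.span {Lm m} ⊔ I ^ m = Ideal.span {L} ⊔ I ^ m) :
    Module.length S (S ⧸ Ideal.span {algebraMap R S L}) ≤ Module.length S (S ⊗[R] M) :=
  length_quotient_span_le_length_baseChange S
    (fittingIdeal_le_span_of_congruences I N Lm hI e hF hc)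

/-- The same with the input in the printed shape of (2.5) / [FW21, Thm. 4.41] ("`Ch(N_m) ⊆ (L_m)`"
whenever `N_m` is torsion; `R` a Noetherian UFD, e.g. `Λ_𝒪^{ur}` componentwise).
[cite: FouquetWan2021, Thm. 4.41 (shape of the conclusion)] -/
theorem length_quotient_le_length_baseChange_of_congruences_printed [IsNoetherianRing R]
    [IsDomain R] [UniqueFactorizationMonoid R] [IsDomain S] [IsDiscreteValuationRing S]
    (hI : I ≤ (⊥ : Ideal R).jacobson)
    (e : ∀ m : ℕ, 1 ≤ m →
      ((M ⧸ (I ^ m • (⊤ : Submodule R M))) ≃ₗ[R] (N m ⧸ (I ^ m • (⊤ : Submodule R (N m))))))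
    (hCh : ∀ m : ℕ, 1 ≤ m → Module.IsTorsion R (N m) →
      charIdeal R (N m) ≤ Ideal.span {Lm m})
    (hc : ∀ m : ℕ, 1 ≤ m → Ideal.span {Lm m} ⊔ I ^ m = Ideal.span {L} ⊔ I ^ m) :
    Module.length S (S ⧸ Ideal.span {algebraMap R S L}) ≤ Module.length S (S ⊗[R] M) :=
  length_quotient_le_length_baseChange_of_congruences S I N Lm hI e
    (fun m hm => fittingIdeal_zero_le_of_charIdeal_le (hCh m hm)) hc

end Coinvariants

end Summit.BirchSwinnertonDyer.Rank1Residual.X11b.CongruenceLimit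

end
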